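import Mathlib
import Literature.NumberTheory.Sieve.IntervalResidueClassSieveSigned
import Literature.NumberTheory.Sieve.BombieriVinogradovLiouvilleHeights
import Summits.Parity.GeneralizedHardyLittlewood.Theorems.ParityLeakOneFifthPlainSplitRoughLiouvilleClasses
import HarnessLib

/-!
# Route ParityLeakOneFifth, crux `PlainSplit` (item stmt-Parity-18382), line `birth`:
# stub `stub_roughLiouville` — Liouville against the rough model, `Σ_{x<n≤2x} b_n λ(n+2) = o(x)`

With the route's `z`-rough model `b_n = 1[P⁻(n) ≥ z]/V(z)`, `z = exp((log log x)²)`,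
`V(z) = ∏_{p<z}(1 − 1/p)`, this file proves the registered stub `stub_roughLiouville` of the BC3
skeleton `Summits/Parity/GeneralizedHardyLittlewood/Cruxes/PlainSplit/Lines/birth.lean` verbatim:
for every `δ > 0`, eventually `|Σ_{x<n≤2x} b_n λ(n+2)| ≤ δ x`.

Proof.  `V · Σ b_n λ(n+2) = Σ_{x<n≤2x, (n,P(z))=1} λ(n+2)` is a SIGNED sifted sum over the shifted
interval `n = x + r`, `1 ≤ r ≤ x` (classes `r ≡ −x (mod p)`), to which the tree's signed interval
sieve `IntervalClassSieve.abs_signedSum_le` (Halberstam–Richert Thm 2.5 for the two non-negative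
sequences `(1 ± σ)/2`) applies with the weight `σ(r) = λ(x+r+2)·1[x+r odd]` (the sifted `n` are odd,
as `z > 2`): at level `L = z^s`,
`|Σ| ≤ C x V e^{−s} + L² + Σ_{d ∣ P(z), d ≤ L} |Σ_{1≤r≤x, d ∣ x+r} σ(r)|`
(dictionary and class reduction: file `ParityLeakOneFifthPlainSplitRoughLiouvilleClasses.lean`).
For even `d` the inner sum vanishes; for odd `d` it is
`Σ_{x+2<m≤2x+2, m ≡ d+2 (mod 2d)} λ(m)` (a reduced class modulo `2d ≤ 2L`), and the sum over `d` is
bounded by two instances of the tree's Bombieri–Vinogradov theorem for `λ` in progressions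
(`BVLiouvilleHeights.bv_liouvilleAP`, level `X^{1/2}(log X)^{−B}`, here `X = 2x+2` and
`2L = 2 exp(s (log log x)²) = X^{o(1)}`), giving `≪ X/log X = o(x V)` since `V ≥ c/(log z)²`.
The growth lemmas in `t = log log x` are those of `ParityLeakOneFifthPlainSplitRoughMass.lean`.
-/

namespace Summit.Parity.GeneralizedHardyLittlewood.Theorems.ParityLeakOneFifth

open Finset Real
open Literature.NumberTheory.Sieve

/-! ### The stub -/

/-- **Stub `stub_roughLiouville` of the BC3 skeleton `Cruxes/PlainSplit/Lines/birth.lean`**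
(registered signature, verbatim): for the `z`-rough model `b_n = 1[P⁻(n) ≥ z]/V(z)`,
`z = exp((log log x)²)`, `V(z) = ∏_{p<z}(1 − 1/p)`, and every `δ > 0`, eventually
`|Σ_{x<n≤2x} b_n λ(n+2)| ≤ δ x`.  Signed fundamental lemma for the shifted interval at level `z^s`
plus Bombieri–Vinogradov for `λ` (tree theorems, see the module docstring). -/
theorem stub_roughLiouville : ∀ δ : ℝ, 0 < δ → ∃ x₀ : ℕ, ∀ x : ℕ, x₀ ≤ x → ∀ (z V : ℝ) (b : ℕ → ℝ), z = Real.exp (Real.log (Real.log (x : ℝ)) ^ 2) → V = ∏ p ∈ (Finset.range ⌈z⌉₊).filter Nat.Prime, (1 - 1 / (p : ℝ)) → b = (fun n : ℕ => if ∀ p ∈ n.primeFactors, z ≤ (p : ℝ) then 1 / V else 0) → |∑ n ∈ Finset.Ioc x (2 * x), b n * (ArithmeticFunction.liouville (n + 2) : ℝ)| ≤ δ * (x : ℝ) := by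
  intro δ hδ
  obtain ⟨C, hC, hFL⟩ := IntervalClassSieve.abs_signedSum_le 1
  obtain ⟨c, hc, hVlow⟩ := IntervalClassSieve.le_prod_one_sub_card_div 1
  obtain ⟨B, Cb, X₀, hB, hCb, hBV⟩ := BVLiouvilleHeights.bv_liouvilleAP 1 one_pos
  -- the sieve parameter `s ≥ 1` with `C e^{-s} ≤ δ/3`
  obtain ⟨s, hs1, hsC⟩ : ∃ s : ℝ, 1 ≤ s ∧ C * Real.exp (-s) ≤ δ / 3 := by
    refine ⟨max 1 (Real.log (3 * C / δ)), le_max_left _ _, ?_⟩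
    have h1 : Real.exp (-max 1 (Real.log (3 * C / δ))) ≤ Real.exp (-Real.log (3 * C / δ)) :=
      Real.exp_le_exp.2 (neg_le_neg (le_max_right _ _))
    rw [Real.exp_neg (Real.log _), Real.exp_log (by positivity)] at h1
    calc C * Real.exp (-max 1 (Real.log (3 * C / δ)))
        ≤ C * (3 * C / δ)⁻¹ := mul_le_mul_of_nonneg_left h1 hC.le
      _ = δ / 3 := by field_simp
  -- growth in `t = log log x`
  have hCb1 : 0 < Cb + 1 := by linarith
  obtain ⟨T₁, hT₁1, hT₁⟩ := exists_quadratic_le_exp (2 * s) 4 (-Real.log (δ * c / 3))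
  obtain ⟨T₂, -, hT₂⟩ := exists_quadratic_le_exp (2 * s) (2 * B) (2 * Real.log 2 * (1 + B))
  obtain ⟨T₃, -, hT₃⟩ := exists_pow_four_le_mul_exp (κ := δ * c / (24 * (Cb + 1))) (by positivity)
  obtain ⟨x₁, hx₁⟩ := exists_nat_loglog_ge (max T₁ (max T₂ T₃))
  refine ⟨max x₁ ⌈X₀⌉₊, fun x hx => ?_⟩
  rintro z V b rfl rfl rfl
  obtain ⟨hxE, hlogx, hTt⟩ := hx₁ x (le_trans (le_max_left _ _) hx)
  have hxX₀ : X₀ ≤ (x : ℝ) := (Nat.le_ceil X₀).trans (by exact_mod_cast le_trans (le_max_right _ _) hx)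
  set t : ℝ := Real.log (Real.log (x : ℝ)) with ht
  have hT₁t : T₁ ≤ t := le_trans (le_max_left _ _) hTt
  have hT₂t : T₂ ≤ t := le_trans ((le_max_left _ _).trans (le_max_right _ _)) hTt
  have hT₃t : T₃ ≤ t := le_trans ((le_max_right _ _).trans (le_max_right _ _)) hTt
  have ht1 : 1 ≤ t := hT₁1.trans hT₁t
  have ht0 : 0 ≤ t := by linarith
  have hx0 : (0 : ℝ) < x := (Real.exp_pos _).trans_le hxE
  have hlogpos : 0 < Real.log (x : ℝ) := (Real.exp_pos _).trans_le hlogx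
  have hexpt : Real.exp t = Real.log (x : ℝ) := by rw [ht, Real.exp_log hlogpos]
  have hxexp : Real.exp (Real.exp t) = (x : ℝ) := by rw [hexpt, Real.exp_log hx0]
  have het1 : Real.exp 1 ≤ Real.exp t := Real.exp_le_exp.2 ht1
  have he2 : (2 : ℝ) < Real.exp 1 := by have := Real.exp_one_gt_d9; linarith
  -- `z = exp(t²)`, `L = z^s`
  set z : ℝ := Real.exp (t ^ 2) with hz
  have hz0 : 0 < z := Real.exp_pos _
  have hz2' : 2 < z := by
    have h1 : Real.exp 1 ≤ z := Real.exp_le_exp.2 (by nlinarith)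
    linarith
  have hz2 : 2 ≤ z := hz2'.le
  have hz1 : 1 ≤ z := by linarith
  have hlogz : Real.log z = t ^ 2 := by rw [hz, Real.log_exp]
  have ht2 : 0 < t ^ 2 := by positivity
  set L : ℝ := z ^ s with hL
  have hL0 : 0 < L := Real.rpow_pos_of_pos hz0 s
  have hzL : z ≤ L := by
    calc z = z ^ (1 : ℝ) := (Real.rpow_one z).symm
      _ ≤ z ^ s := Real.rpow_le_rpow_of_exponent_le hz1 hs1
  have hlogL : Real.log L / Real.log z = s := by
    rw [hL, Real.log_rpow hz0, hlogz]; field_simp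
  have hLexp : L = Real.exp (s * t ^ 2) := by
    rw [hL, hz, ← Real.exp_mul]; ring_nf
  have hL2 : L ^ 2 = Real.exp (2 * s * t ^ 2) := by
    rw [hLexp, ← Real.exp_nat_mul]; ring_nf
  -- the classes `r ≡ -x (mod p)`
  set Ω : ℕ → Finset ℕ := fun p => {(p - x % p) % p} with hΩ
  have hΩlt : ∀ p : ℕ, p.Prime → ∀ r ∈ Ω p, r < p := by
    intro p hp r hr
    rw [hΩ, Finset.mem_singleton] at hr
    rw [hr]; exact Nat.mod_lt _ hp.pos
  have hΩle : ∀ p : ℕ, p.Prime → #(Ω p) ≤ 1 := fun p _ => by rw [hΩ, Finset.card_singleton]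
  have hΩp : ∀ p : ℕ, p.Prime → #(Ω p) < p := fun p hp => by
    rw [hΩ, Finset.card_singleton]; exact hp.one_lt
  have hPB : Nat.primesBelow ⌈z⌉₊ = (Finset.range ⌈z⌉₊).filter Nat.Prime := rfl
  have hprod : ∏ p ∈ Nat.primesBelow ⌈z⌉₊, (1 - (#(Ω p) : ℝ) / p) =
      ∏ p ∈ (Finset.range ⌈z⌉₊).filter Nat.Prime, (1 - 1 / (p : ℝ)) := by
    rw [hPB]
    refine Finset.prod_congr rfl fun p _ => ?_
    rw [hΩ, Finset.card_singleton, Nat.cast_one]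
  set V : ℝ := ∏ p ∈ (Finset.range ⌈z⌉₊).filter Nat.Prime, (1 - 1 / (p : ℝ)) with hV
  have hVc : c / t ^ 4 ≤ V := by
    have h := hVlow Ω hΩle hΩp z hz2
    rw [hprod, hlogz] at h
    have e : (t ^ 2) ^ (2 * 1) = t ^ 4 := by ring
    rwa [e] at h
  have ht4 : 0 < t ^ 4 := by positivity
  have hV0 : 0 < V := lt_of_lt_of_le (div_pos hc ht4) hVc
  -- the weight `σ`
  set σ : ℕ → ℝ := fun r => if 2 ∣ x + r then 0 else (ArithmeticFunction.liouville (x + r + 2) : ℝ)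
    with hσ
  have hσ1 : ∀ r, |σ r| ≤ 1 := by
    intro r; simp only [hσ]
    split_ifs
    · simp
    · exact abs_liouville_le_one _
  -- dictionary
  have hdict := sum_model_liouville_eq x hz2' V
  rw [hPB] at hdict
  rw [hdict, abs_mul, abs_of_pos (by positivity : (0 : ℝ) < 1 / V), one_div, inv_mul_le_iff₀ hV0]
  -- the signed fundamental lemma
  have hmain := hFL x Ω hΩlt hΩle hΩp z L hz2 hzL σ hσ1
  rw [hprod, hlogL, hPB] at hmain
  refine hmain.trans ?_
  -- the remainder classes, modulus by modulus
  -- the residue selector: `d + 2 (mod 2d)` at `q = 2d`, `d` odd (`q ≡ 2 (mod 4)`), else `1`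
  set a : (q : ℕ) → ZMod q := fun q => if q % 4 = 2 then ((q / 2 + 2 : ℕ) : ZMod q) else 1
    with ha
  have hunit' : ∀ q : ℕ, 1 ≤ q → IsUnit (a q) := by
    intro q hq
    simp only [ha]
    split_ifs with h
    · rw [ZMod.isUnit_iff_coprime]
      obtain ⟨d, rfl⟩ : ∃ d, q = 2 * d := ⟨q / 2, by omega⟩
      have hodd : d % 2 = 1 := by omega
      rw [Nat.mul_div_cancel_left _ two_pos]
      refine Nat.Coprime.mul_right ?_ ?_
      · exact Nat.coprime_two_right.2 (Nat.odd_iff.2 (by omega))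
      · rw [add_comm, Nat.coprime_add_self_left]
        exact Nat.coprime_two_left.2 (Nat.odd_iff.2 hodd)
    · exact isUnit_one
  set S : ℕ → ℕ → ℝ := fun N q => ∑ m ∈ (Finset.Icc 1 N).filter
      (fun m : ℕ => (m : ZMod q) = a q), (ArithmeticFunction.liouville m : ℝ) with hS
  have hclass : ∀ d ∈ (primesProdBelow z).divisors.filter (fun d : ℕ => (d : ℝ) ≤ L),
      ∑ c ∈ (Finset.range d).filter (fun c : ℕ => ∀ q ∈ d.primeFactors, c % q ∈ Ω q),
        |∑ r ∈ (Finset.Icc 1 x).filter (fun r : ℕ => r % d = c), σ r| ≤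
        |S (2 * x + 2) (2 * d)| + |S (x + 2) (2 * d)| := by
    intro d hd
    have hd' := Nat.mem_divisors.1 (Finset.mem_filter.1 hd).1
    have hsq : Squarefree d := (squarefree_primesProdBelow z).squarefree_of_dvd hd'.1
    refine (sum_admissible_le hsq x σ).trans ?_
    rcases Nat.even_or_odd d with heven | hodd
    · -- even `d`: every term of the class sum vanishes
      have h0 : ∑ r ∈ (Finset.Icc 1 x).filter (fun r : ℕ => d ∣ x + r), σ r = 0 := by
        refine Finset.sum_eq_zero fun r hr => ?_
        have hdr := (Finset.mem_filter.1 hr).2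
        simp only [hσ]
        rw [if_pos ((even_iff_two_dvd.1 heven).trans hdr)]
      rw [h0, abs_zero]; positivity
    · have h4 : (2 * d) % 4 = 2 := by have := Nat.odd_iff.1 hodd; omega
      have hres : a (2 * d) = ((d + 2 : ℕ) : ZMod (2 * d)) := by
        simp only [ha]
        rw [if_pos h4, Nat.mul_div_cancel_left _ two_pos]
      simp only [hS]
      rw [hres]
      exact abs_classSum_le_of_odd hodd x
  -- Bombieri–Vinogradov
  set X : ℝ := ((2 * x + 2 : ℕ) : ℝ) with hX
  have hxX : (x : ℝ) ≤ X := by rw [hX]; push_cast; linarith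
  have hX4 : X ≤ 4 * x := by
    rw [hX]; push_cast
    have : (1 : ℝ) ≤ x := (Real.one_le_exp (Real.exp_pos _).le).trans hxE
    linarith
  have hX0 : 0 < X := hx0.trans_le hxX
  have hXx₀ : X₀ ≤ X := hxX₀.trans hxX
  have hlogX : Real.exp t ≤ Real.log X := by rw [hexpt]; exact Real.log_le_log hx0 hxX
  have hlogX' : Real.log X ≤ 2 * Real.exp t := by
    have h4 : Real.log X ≤ Real.log 4 + Real.log x := by
      rw [← Real.log_mul (by norm_num) hx0.ne']; exact Real.log_le_log hX0 hX4
    have hl4 : Real.log 4 ≤ Real.exp 1 := by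
      have := Real.log_two_lt_d9
      rw [show (4 : ℝ) = 2 ^ 2 by norm_num, Real.log_pow]; push_cast; linarith
    linarith [hexpt]
  have hlogX0 : 0 < Real.log X := (Real.exp_pos t).trans_le hlogX
  set Q : ℕ := 2 * ⌊L⌋₊ with hQ
  have hQL : (Q : ℝ) ≤ 2 * L := by
    rw [hQ]; push_cast; linarith [Nat.floor_le hL0.le]
  have hlevel : (Q : ℝ) ≤ X ^ (1 / 2 : ℝ) / Real.log X ^ B := by
    refine hQL.trans ?_
    rw [le_div_iff₀ (Real.rpow_pos_of_pos hlogX0 B)]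
    have h1 : Real.log X ^ B ≤ (2 * Real.exp t) ^ B := Real.rpow_le_rpow hlogX0.le hlogX' hB.le
    have h2 : (2 * Real.exp t) ^ B = Real.exp (B * Real.log 2 + B * t) := by
      rw [Real.mul_rpow (by norm_num) (Real.exp_pos t).le, Real.rpow_def_of_pos (by norm_num : (0:ℝ) < 2),
        ← Real.exp_mul, Real.exp_add]; ring_nf
    have h3 : Real.exp (Real.exp t / 2) ≤ X ^ (1 / 2 : ℝ) := by
      calc Real.exp (Real.exp t / 2) = (x : ℝ) ^ (1 / 2 : ℝ) := by
            rw [← hxexp, ← Real.exp_mul]; ring_nf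
        _ ≤ X ^ (1 / 2 : ℝ) := Real.rpow_le_rpow hx0.le hxX (by norm_num)
    have h4 := hT₂ t hT₂t
    calc 2 * L * Real.log X ^ B ≤ 2 * L * (2 * Real.exp t) ^ B :=
          mul_le_mul_of_nonneg_left h1 (by positivity)
      _ = Real.exp (Real.log 2 + s * t ^ 2 + (B * Real.log 2 + B * t)) := by
          rw [h2, hLexp]
          simp only [Real.exp_add, Real.exp_log (show (0 : ℝ) < 2 by norm_num)]
      _ ≤ Real.exp (Real.exp t / 2) := Real.exp_le_exp.2 (by linarith)
      _ ≤ X ^ (1 / 2 : ℝ) := h3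
  have hunit : ∀ q ∈ Finset.Icc 1 Q, IsUnit (a q) := fun q hq => hunit' q (Finset.mem_Icc.1 hq).1
  have hBV₁ := hBV X hXx₀ Q hlevel (fun _ => 2 * x + 2) (fun _ => by rw [hX]) a hunit
  have hBV₂ := hBV X hXx₀ Q hlevel (fun _ => x + 2)
    (fun _ => by rw [hX]; push_cast; linarith) a hunit
  rw [Real.rpow_one] at hBV₁ hBV₂
  -- sum over the moduli `d ↦ 2d`
  have hsumd : ∑ d ∈ (primesProdBelow z).divisors.filter (fun d : ℕ => (d : ℝ) ≤ L),
      (|S (2 * x + 2) (2 * d)| + |S (x + 2) (2 * d)|) ≤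
      ∑ q ∈ Finset.Icc 1 Q, (|S (2 * x + 2) q| + |S (x + 2) q|) := by
    rw [← Finset.sum_image (f := fun q => |S (2 * x + 2) q| + |S (x + 2) q|)
      (s := (primesProdBelow z).divisors.filter (fun d : ℕ => (d : ℝ) ≤ L)) (g := fun d => 2 * d)
      (fun a _ b _ h => by simpa using h)]
    refine Finset.sum_le_sum_of_subset_of_nonneg ?_ (fun _ _ _ => by positivity)
    intro q hq
    rw [Finset.mem_image] at hq
    obtain ⟨d, hd, rfl⟩ := hq
    rw [Finset.mem_filter] at hd
    have hd0 : 0 < d := Nat.pos_of_mem_divisors hd.1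
    rw [Finset.mem_Icc]
    refine ⟨by omega, ?_⟩
    rw [hQ]
    exact Nat.mul_le_mul_left 2 (Nat.le_floor hd.2)
  have hE : ∑ d ∈ (primesProdBelow z).divisors.filter (fun d : ℕ => (d : ℝ) ≤ L),
      ∑ c ∈ (Finset.range d).filter (fun c : ℕ => ∀ q ∈ d.primeFactors, c % q ∈ Ω q),
        |∑ r ∈ (Finset.Icc 1 x).filter (fun r : ℕ => r % d = c), σ r| ≤ 2 * (Cb * X / Real.log X) := by
    refine (Finset.sum_le_sum hclass).trans (hsumd.trans ?_)
    rw [Finset.sum_add_distrib]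
    have e1 : ∑ q ∈ Finset.Icc 1 Q, |S (2 * x + 2) q| ≤ Cb * X / Real.log X := hBV₁
    have e2 : ∑ q ∈ Finset.Icc 1 Q, |S (x + 2) q| ≤ Cb * X / Real.log X := hBV₂
    linarith
  -- growth bounds
  have hterm1 : C * x * V * Real.exp (-s) ≤ δ / 3 * x * V := by
    have h := mul_le_mul_of_nonneg_right hsC (by positivity : (0 : ℝ) ≤ x * V)
    calc C * x * V * Real.exp (-s) = C * Real.exp (-s) * (x * V) := by ring
      _ ≤ δ / 3 * (x * V) := h
      _ = δ / 3 * x * V := by ring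
  have hterm2 : L ^ 2 ≤ δ / 3 * x * V := by
    have h1 : t ^ 4 ≤ Real.exp (4 * t) := by
      have h := Real.add_one_le_exp t
      have h' : t ≤ Real.exp t := by linarith
      calc t ^ 4 ≤ (Real.exp t) ^ 4 := pow_le_pow_left₀ ht0 h' 4
        _ = Real.exp (4 * t) := by rw [← Real.exp_nat_mul]; norm_num
    have h2 := hT₁ t hT₁t
    have hδc : 0 < δ * c / 3 := by positivity
    have hgrowth : Real.exp (2 * s * t ^ 2) * t ^ 4 ≤ δ * c / 3 * x := by
      calc Real.exp (2 * s * t ^ 2) * t ^ 4 ≤ Real.exp (2 * s * t ^ 2) * Real.exp (4 * t) :=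
            mul_le_mul_of_nonneg_left h1 (Real.exp_pos _).le
        _ = Real.exp (2 * s * t ^ 2 + 4 * t + -Real.log (δ * c / 3) + Real.log (δ * c / 3)) := by
            rw [← Real.exp_add]; ring_nf
        _ ≤ Real.exp (Real.exp t + Real.log (δ * c / 3)) := Real.exp_le_exp.2 (by linarith)
        _ = δ * c / 3 * x := by rw [Real.exp_add, Real.exp_log hδc, hxexp, mul_comm]
    rw [hL2]
    have h3 : Real.exp (2 * s * t ^ 2) ≤ δ * c / 3 * x / t ^ 4 := by
      rw [le_div_iff₀ ht4]; exact hgrowth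
    calc Real.exp (2 * s * t ^ 2) ≤ δ * c / 3 * x / t ^ 4 := h3
      _ = δ / 3 * x * (c / t ^ 4) := by ring
      _ ≤ δ / 3 * x * V := mul_le_mul_of_nonneg_left hVc (by positivity)
  have hterm3 : 2 * (Cb * X / Real.log X) ≤ δ / 3 * x * V := by
    have h1 := hT₃ t hT₃t
    have hA : 2 * (Cb * X / Real.log X) ≤ 8 * (Cb + 1) * x / Real.exp t := by
      have e1 : Cb * X ≤ Cb * (4 * x) := mul_le_mul_of_nonneg_left hX4 hCb
      have e2 : Cb * (4 * x) ≤ (Cb + 1) * (4 * x) :=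
        mul_le_mul_of_nonneg_right (by linarith) (by positivity)
      have hnum : 2 * (Cb * X) ≤ 8 * (Cb + 1) * x := by linarith [e1, e2]
      calc 2 * (Cb * X / Real.log X) = 2 * (Cb * X) / Real.log X := by ring
        _ ≤ 8 * (Cb + 1) * x / Real.log X := div_le_div_of_nonneg_right hnum hlogX0.le
        _ ≤ 8 * (Cb + 1) * x / Real.exp t :=
          div_le_div_of_nonneg_left (by positivity) (Real.exp_pos t) hlogX
    have hB' : 8 * (Cb + 1) * x / Real.exp t ≤ δ / 3 * x * (c / t ^ 4) := by
      rw [div_le_iff₀ (Real.exp_pos t)]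
      have h2 : 8 * (Cb + 1) * t ^ 4 ≤ δ / 3 * c * Real.exp t := by
        have h := mul_le_mul_of_nonneg_left h1 (by positivity : (0 : ℝ) ≤ 8 * (Cb + 1))
        calc 8 * (Cb + 1) * t ^ 4 ≤ 8 * (Cb + 1) * (δ * c / (24 * (Cb + 1)) * Real.exp t) := h
          _ = δ / 3 * c * Real.exp t := by field_simp; ring
      have h3 := mul_le_mul_of_nonneg_left h2 (by positivity : (0 : ℝ) ≤ x / t ^ 4)
      calc 8 * (Cb + 1) * x = x / t ^ 4 * (8 * (Cb + 1) * t ^ 4) := by field_simp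
        _ ≤ x / t ^ 4 * (δ / 3 * c * Real.exp t) := h3
        _ = δ / 3 * x * (c / t ^ 4) * Real.exp t := by ring
    have hC' : δ / 3 * x * (c / t ^ 4) ≤ δ / 3 * x * V :=
      mul_le_mul_of_nonneg_left hVc (by positivity)
    linarith
  calc C * x * V * Real.exp (-s) + L ^ 2 +
        ∑ d ∈ (primesProdBelow z).divisors.filter (fun d : ℕ => (d : ℝ) ≤ L),
          ∑ c ∈ (Finset.range d).filter (fun c : ℕ => ∀ q ∈ d.primeFactors, c % q ∈ Ω q),
            |∑ r ∈ (Finset.Icc 1 x).filter (fun r : ℕ => r % d = c), σ r|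
      ≤ δ / 3 * x * V + δ / 3 * x * V + δ / 3 * x * V := by linarith [hterm1, hterm2, hE, hterm3]
    _ = V * (δ * x) := by ring

end Summit.Parity.GeneralizedHardyLittlewood.Theorems.ParityLeakOneFifth
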